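import Summits.ResolutionOfSingularities.ResolutionOfSingularities.Theses.PAlteration
import Summits.ResolutionOfSingularities.ResolutionOfSingularities.Theorems.PAlterationPialtPiAssembly
import Summits.ResolutionOfSingularities.ResolutionOfSingularities.Theorems.PAlterationPialtPiTwoModelPatchingOfPialt
import HarnessLib

/-!
# Skeleton `radicially-regular-endgame` (from `SketchIdeator2`, Card A) for crux stmt-ResolutionOfSingularities-0555 `Pialt` —
# v6 "PiPatching": the RADICIAL-PATCHING half made EXACT — `Pialt ⟺ PiTMP` modulo the published `Temkin2013`

Line lead c5 (prover-line-stmt-ResolutionOfSingularities-0555-c5-0, 2026-08-17).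

Card A cut the crux into a local half (tame resolution / local uniformization) and a local-to-global half
(`RadicialPatching`). Leads a1–c4 drove both halves to atoms THROUGH THE SUMMIT (v4/v5: LU ∧ two-model patching
⟺ resolution over perfect fields) — "nothing Pialt-specific survives" (STRATEGY-CENSUS (D1)). This reshape keeps
the local half a THEOREM IN PRINT — Temkin's inseparable local uniformization (Temkin 2013, Thm. 1.3.2: every
valuation is uniformized on SOME finite purely inseparable extension of the function field; named fact
`Temkin2013`) — and isolates the ENTIRE open content of the crux in ONE local-to-global statement that uses the
purely inseparable freedom the crux grants:

* `stub_piTwoModelPatching (p) : PiTMP_p` — **purely inseparable two-model patching**: for a field `k` of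
  characteristic `p`, finite purely inseparable `L₁, L₂ ⊇ K` and proper models `Mᵢ` of `Lᵢ/k`, there are a finite
  purely inseparable `L ⊇ L₁, L₂` and a proper model `N` of `L/k` dominating both `Mᵢ` along `Lᵢ → L` and REGULAR
  at every point over `Reg M₁ ∪ Reg M₂`. (Piltant 2013 Prop. 5.1 for `P = P_reg` with the field allowed to grow
  purely inseparably; lead a1's "patching theorem with inseparable twists", now a registered statement.)

KERNEL-CHECKED (all files `--supports stmt-0555`, axioms standard):
* `pialt_of_temkin2013_piTwoModelPatching : Temkin2013 → (∀ p, p.Prime → PiTMP_p) → Pialt`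
  (`Theorems/PAlterationPialtPiAssembly.lean`; engine `exists_regular_piModel_of_temkin2013_of_piTwoModelPatching`,
  `Theorems/PAlterationPialtPiEngine.lean`: Temkin per valuation, `Zar(L_v/k) ≅ Zar(K/k)` along p.i. `L_v/K`
  (`Theorems/PAlterationPialtPiTransfer.lean`), quasi-compactness, projective closures, patch the finite list with
  PiTMP — fields growing —, final model regular; conversion `pialtConclusion_of_regular_piModel`,
  `Theorems/PAlterationPialtConclusionOfRegularPiModel.lean`: relative normalisation, ZMT, radiciality over a
  normal base);
* `piTwoModelPatching_of_pialt : Pialt → ∀ p, p.Prime → PiTMP_p` (`Theorems/PAlterationPialtPiTwoModelPatchingOfPialt.lean`: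
  Pialt at the join of the normalisations of `M₁, M₂` in a common finite p.i. field).
Hence **`Pialt ⟺ (∀ p, PiTMP_p)` modulo `Temkin2013`**: a ONE-atom, CRUX-EXACT residual (`pialt_iff_piTwoModelPatching`
below). `PiTMP_p` and the summit's same-field patching `TwoModelPatching p` are formally INCOMPARABLE: TMP cannot
absorb the field growth (regularity is not stable under inseparable base change — barrier `InseparableBaseChange`),
PiTMP cannot shrink the field back to `K`.

Stubs: `stub_temkin2013` (NAMED FACT, published; in-tree leaf `Temkin2013RelativeCurveSmoothFibre`, Berkovich-analytic)
and `stub_piTwoModelPatching` (OPEN ⟺ the crux). Composition `Pialt_of` = the assembly theorem.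
-/

set_option linter.dupNamespace false

noncomputable section

open CategoryTheory AlgebraicGeometry
open Literature.AlgebraicGeometry.Resolution
open Summit.ResolutionOfSingularities.ResolutionOfSingularities.Theses.PAlteration (Pialt)

namespace Summit.ResolutionOfSingularities.ResolutionOfSingularities.Theorems.Pialt.RadiciallyRegular

/-! ## Stubs -/

/-- STUB (ATOM — named fact, genuinely large): **Temkin's inseparable local uniformization** (Temkin 2013,
Thm. 1.3.2, weak form `Literature.AlgebraicGeometry.Resolution.Temkin2013`): every valuation of a finitely generated
`K/k` is uniformized on a finite purely inseparable extension of `K`. Published theorem; in-tree discharge programme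
`Temkin2013.of_smoothFibre` (leaf `Temkin2013RelativeCurveSmoothFibre`, Berkovich-analytic Steps 2–3 of Thm. 3.3.1). -/
theorem stub_temkin2013 : Temkin2013.{0} := by
  sorry

/-- STUB (ATOM — OPEN, EQUIVALENT TO THE CRUX modulo `Temkin2013`): **purely inseparable two-model patching in
characteristic `p`** (`PiTMP_p`). For a field `k` of characteristic `p`, a field `K ⊇ k`, finite purely inseparable
extensions `L₁, L₂` of `K` and proper models `M₁` of `L₁/k`, `M₂` of `L₂/k`, there are a finite purely inseparable
extension `L` of `K` with `K`-embeddings `ιᵢ : Lᵢ → L` and a proper model `N` of `L/k` with `k`-morphisms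
`φᵢ : N → Mᵢ` compatible with the generic points along `ιᵢ`, such that `N` is regular at every point mapping to a
regular point of `M₁` or of `M₂`. Implied by the crux (`piTwoModelPatching_of_pialt`); with `Temkin2013` it implies
the crux (`pialt_of_temkin2013_piTwoModelPatching`). A counterexample is a pair of purely inseparable models that no
purely inseparable refinement patches — a far more concrete target than the crux itself. -/
theorem stub_piTwoModelPatching (p : ℕ) (hp : p.Prime) :
    ∀ (k : Type) [Field k] [CharP k p] (K : Type) [Field K] [Algebra k K]
      (L₁ : Type) [Field L₁] [Algebra K L₁] [Algebra k L₁] [IsScalarTower k K L₁]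
      [FiniteDimensional K L₁] [IsPurelyInseparable K L₁]
      (L₂ : Type) [Field L₂] [Algebra K L₂] [Algebra k L₂] [IsScalarTower k K L₂]
      [FiniteDimensional K L₂] [IsPurelyInseparable K L₂]
      (M₁ : ProperModel k L₁) (M₂ : ProperModel k L₂),
      ∃ (L : Type) (_ : Field L) (_ : Algebra K L) (_ : Algebra k L) (_ : IsScalarTower k K L)
        (ι₁ : L₁ →ₐ[K] L) (ι₂ : L₂ →ₐ[K] L),
        FiniteDimensional K L ∧ IsPurelyInseparable K L ∧
        ∃ (N : ProperModel k L) (φ₁ : N.X ⟶ M₁.X) (φ₂ : N.X ⟶ M₂.X),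
          φ₁ ≫ M₁.π = N.π ∧ φ₂ ≫ M₂.π = N.π ∧
          N.gen ≫ φ₁ = Spec.map (CommRingCat.ofHom ι₁.toRingHom) ≫ M₁.gen ∧
          N.gen ≫ φ₂ = Spec.map (CommRingCat.ofHom ι₂.toRingHom) ≫ M₂.gen ∧
          ∀ n : N.X, (IsRegularLocalRing (M₁.X.presheaf.stalk (φ₁.base n)) ∨
              IsRegularLocalRing (M₂.X.presheaf.stalk (φ₂.base n))) →
            IsRegularLocalRing (N.X.presheaf.stalk n) := by
  sorry

/-! ## Exactness — LANDED (`Theorems/PAlterationPialtPiExactness.lean`): `pialt_iff_piTwoModelPatching (hT : Temkin2013) : Pialt ↔ ∀ p, PiTMP_p`. -/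

/-! ## Composition -/

/-- COMPOSITION: the crux BY NAME from the two stubs (Temkin's local existence + purely inseparable patching). -/
theorem Pialt_of : Pialt :=
  PiPatching.pialt_of_temkin2013_piTwoModelPatching stub_temkin2013 stub_piTwoModelPatching

end Summit.ResolutionOfSingularities.ResolutionOfSingularities.Theorems.Pialt.RadiciallyRegular

end
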